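import Summits.BirchSwinnertonDyer.Rank1Residual.X11b.FrameIdealRigidity
import Summits.BirchSwinnertonDyer.Rank1Residual.X11b.BDPRouteHsiehFrame
import Literature.NumberTheory.EllipticCurves.KatzPAdicLFunctionCMFieldBaseChangeLine
import HarnessLib

set_option linter.dupNamespace false -- `Summit.BirchSwinnertonDyer.BirchSwinnertonDyer.Theorems.…` (summit = sub)
set_option autoImplicit false

/-!
# Crux `EisensteinHeartFlatCMInertBadKPrime` (stmt-BirchSwinnertonDyer-21341), line `hsieh-lambda`, layer 2 (V2):
# KATZ–HSIEH IDEAL RIGIDITY — a series whose values on Hsieh's range are Hsieh's values times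
# `c₀ · c₁ⁿ · δ(χ)` (`c₀, c₁ ≠ 0`, `δ` power-multiplicative) generates THE SAME IDEAL UP TO A NON-ZERO CONSTANT

Route `BiquadraticEisensteinDescent` (cell `pub/bsd-wall`, width seat `bsd-wall-cm-bed-w3`, successor of the V1 typer;
lead `bsd-wall-cm-bed-p1`, `LAYER2-VOCAB-BRIEF.md` item V2 "(E1a) KATZ–HSIEH FACTORISATION on the line … the
p-power-blind heart only needs equality of ideals UP TO A NON-ZERO CONSTANT, which the tree's rigidity style
(`R1.exists_unit_mul_eq_of_values`) proves from equality of values up to a constant"). THEOREMS ONLY (no definition,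
no named fact, no `sorry`); valid at every ODD prime `p` over an imaginary quadratic `K` with `κ` anticyclotomic;
supports stmt-BirchSwinnertonDyer-21341 as a helper; nothing about the crux's input or any case of BSD is asserted.

## What is proved, and why the ∀∀-form holds (answering the V2 design note of the previous w3 generation)

On the `K′`-line of the biquadratic CM field `L = K_CM·K′` a Hsieh witness `Q_H` (`IsHsiehLFunction ι 𝔭 κ γ f A Ω_K C Ω_p
Q_H`, Hsieh Doc. Math. 19 Thm. A at any level) and a Katz base-change-line series `G` (`KatzCM.IsBaseChangeLine ι Σ_p S T
κ γ λ ϑ C′ Ω Ω_p′ G`, Hsieh Crelle 688 Prop. 4.9) are evaluated at LITERALLY the same points `T = r(γ) − 1` (same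
`(χ, r, γ)`; V1 file). Their displays differ, point by point, by (i) `χ`-INDEPENDENT constants (Gauss sum / local
root numbers / `[𝒪_L^× : 𝒪_F^×]`, `√|D_F|`, a ratio of the two `C`'s), (ii) `n`-GEOMETRIC factors at a character of
infinity type `(n, −n)` (`π^{4n}`, `(16A²/p)ⁿ`, the period ratios `(Ω_{L}·Ω_{L}′/Ω_{K′}²)^{2n}`-type and their
`p`-adic twins — whatever the periods of the two frames are), and (iii) the explicit Katz Euler factor
`(χ∘N_{L/K′})(ϖ_{𝔓′})^{−a(λ_{𝔓′})}` of `KatzCM.eulerFactor` at the prime of the `p`-adic CM type, which is NOT a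
constant but IS multiplicative in `χ`. So the values of `G` on Hsieh's range have the SHAPE
`c₀ · c₁ⁿ · δ(χ) · (Hsieh's value)` with `c₀, c₁ ∈ ℂ_p^×` and `δ(χ^k) = δ(χ)^k`, `δ(χ) ≠ 0`. Along the test characters
`φ₀^{p^a j}` of the tree's interpolation-character supply (`exists_interpolationCharacter`: `φ₀` unramified
everywhere of type `(m, −m)`, avatar `e ∘ ψ` through `κ`, `x₀ = ψ(γ)` a principal unit with `x₀^{p^k} ≠ 1`) such a
shape is `c₀ · bʲ` with `b = c₁^{m p^a} · δ(φ₀)^{p^a} ≠ 0`, and the two series are read at `xʲ − 1`, `x = x₀^{p^a}`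
with `‖x − 1‖ < p⁻¹`. Hence route R1's PROVED abstract rigidity `R1.exists_unit_mul_eq_of_values` ("frames tied
along the powers of a principal unit differ by a unit") applies after moving `c₀` (or `c₀⁻¹`, whichever lies in
`𝒪_{ℂ_p}`) onto one side: NO compatible choice of periods is needed, exactly as for two BDP frames with arbitrary
periods (`R1.exists_unit_mul_eq_of_isBDPLFunctionInt`, whose proof is followed here line by line — CREDIT
multr1-p1 gen 25, `X11b/FrameIdealRigidity.lean`).

* §1 **`exists_unit_C_mul_eq_of_values_shape`** (abstract, any value assignment `F χ n`): `Q` with values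
  `F χ n` and `G` with values `c₀ c₁ⁿ δ(χ) F χ n` on the range satisfy `G = U·C(c)·Q` or `C(c)·G = U·Q` for a
  UNIT `U` and a constant `c ∈ 𝒪_{ℂ_p} ∖ 0`; **`exists_span_C_mul_eq_of_values_shape`**: hence
  `(C(c)·G) = (C(c′)·Q)` as ideals of `𝒪_{ℂ_p}⟦T⟧` for some `c, c′ ≠ 0` — the hypothesis `hspan` of the lead's
  socket `…ConstantScaling.heartShape_of_sockets` (`Q_L := G`, `Q_H := Q`).
* §2 **`exists_span_C_mul_eq_of_isHsiehLFunction`**: `Q := Q_H` a Hsieh witness (`F χ n = ι⁻¹(Hsieh's display)·Ω_p^{4n}`;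
  NO condition on `A, Ω_K, C, Ω_p`).
* §3 **`exists_span_C_mul_eq_of_isBaseChangeLine`**: `G` a Katz base-change-line series; the remaining
  hypothesis `hdisp` is the POINTWISE display relation "`ι⁻¹(Katz display at χ∘N)·∏_w Ω_{p,w}′^{k+2κ_w} =
  c₀ c₁ⁿ δ(χ) · ι⁻¹(Hsieh display at χ)·Ω_p^{4n}` for some admissible `(k, κ, hL)`" — an identity between complex
  `L`-values and periods (automorphic induction `L(½, π_{f,K′} ⊗ χ) = L(0, λ·χ∘N_{L/K′})` for the CM form
  `f = θ_{ψ_W}`, `K_CM ≠ K′`, plus bookkeeping of the two displays), which is what layer 2 must now supply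
  (D2 of this seat); nothing of it is asserted here.

References: [Hsieh2014] Thm. A (Doc. Math. 19 p. 712); [Hsieh2014mu] Prop. 4.9 (Crelle 688 §4.8); [Castella2018]
Thm. 3.1 (the frame currency); [Washington1997] §5.1 (`(1+T)^x`), §7.1.
-/

noncomputable section

open scoped Classical Topology NumberField
open Filter NumberField IsDedekindDomain Field PowerSeries
open Literature.NumberTheory.EllipticCurves Literature.NumberTheory.GaloisRepresentations
open Summit.BirchSwinnertonDyer.Rank1Residual.X11b
open Summit.BirchSwinnertonDyer.Rank1Residual.X11b.Three.LambdaSupply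
open Summit.BirchSwinnertonDyer.Rank1Residual.X11b.LambdaSupply
open Summit.BirchSwinnertonDyer.Rank1Residual.X11b.Three.LambdaSupply.PadicUnits

namespace Summit.BirchSwinnertonDyer.BirchSwinnertonDyer.Theorems.BiquadraticEisensteinDescentEisensteinHeartFlatCMInertBadKPrimeKatzHsiehRigidity

variable {p : ℕ} [Fact p.Prime] {K : Type} [Field K] [NumberField K]
  {ι : PadicAlgCl p ≃+* ℂ} {κ : ZpExtension K p} {γ : absoluteGaloisGroup K}

/-! ### §0 `𝒪_{ℂ_p}` in norm currency -/

/-- `‖x‖ ≤ 1 ⟹ x ∈ 𝒪_{ℂ_p}` (the valuation subring of `ℂ_p` is its closed unit ball; the norm of `ℂ_p` is the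
real avatar of its valuation). [folklore] -/
theorem mem_padicComplexInt_of_norm_le_one {x : ℂ_[p]} (hx : ‖x‖ ≤ 1) : x ∈ 𝓞_ℂ_[p] := by
  have h : x ∈ 𝓞_ℂ_[p] ↔ ‖x‖ ≤ 1 := by
    rw [PadicComplexInt, Valuation.mem_valuationSubring_iff, PadicComplex.norm_eq_norm,
      Valuation.norm_def]
    simp
  exact h.mpr hx

/-! ### §1 The abstract rigidity: values of shape `c₀ · c₁ⁿ · δ(χ) · F(χ, n)` -/

/-- **KATZ–HSIEH RIGIDITY, abstract form.** Odd `p`, `K` imaginary quadratic, `κ : Γ_K ↠ ℤ_p` anticyclotomic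
with topological generator `γ`. Let `Q, G ∈ 𝒪_{ℂ_p}⟦T⟧` take, at every point `T = r(γ) − 1` of the anticyclotomic
range (`χ` a Hecke character of `K` unramified everywhere, of infinity type `(n, −n)` with `n > 0`, `r` its
`p`-adic avatar factoring through `κ`), the values `F χ n` resp. `c₀ · c₁ⁿ · δ(χ) · F χ n`, where `c₀, c₁ ∈ ℂ_p^×`
and `δ : HeckeCharacter K → ℂ_p ∖ 0` is power-multiplicative (`δ(χ^k) = δ(χ)^k`). Then `G = U · C(c) · Q` or
`C(c) · G = U · Q` for a UNIT `U ∈ 𝒪_{ℂ_p}⟦T⟧` and a constant `c ∈ 𝒪_{ℂ_p} ∖ 0` (`c = c₀` if `‖c₀‖ ≤ 1`, else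
`c = c₀⁻¹`). Proof: at the test characters `φ₀^{p^a j}` of `exists_interpolationCharacter` (type `(m p^a j, −m p^a j)`,
avatar `e ∘ ψ^{p^a j}`, point `xʲ − 1` with `x = ψ(γ)^{p^a}`, `‖x − 1‖ < p⁻¹`, `x ≠ 1`) the two values differ by
`c₀ · bʲ`, `b = c₁^{m p^a} δ(φ₀)^{p^a} ≠ 0`; then `R1.exists_unit_mul_eq_of_values`.
[cite: Castella2018, Thm. 3.1 (arXiv:1704.06608 p. 9)] [cite: Washington1997, §5.1] -/
theorem exists_unit_C_mul_eq_of_values_shape (hp2 : p ≠ 2) (hK : IsImaginaryQuadratic K)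
    (hκ : κ.IsAnticyclotomic) (hγ : κ.IsTopGenerator γ) {F : HeckeCharacter K → ℕ → ℂ_[p]}
    {Q G : PowerSeries 𝓞_ℂ_[p]}
    (hQ : ∀ (χ : HeckeCharacter K) (n : ℕ), 0 < n → (∀ v : HeightOneSpectrum (𝓞 K), χ.IsUnramifiedAt v) →
      χ.HasInfinityType (fun _ ↦ (n : ℤ)) (fun _ ↦ -(n : ℤ)) →
      ∀ r : FramedGaloisRep K (PadicAlgCl p) 1, IsPAdicAvatarOf ι χ r → FactorsThroughZp κ r →
        IntSeries.HasValueAt Q (avatarValueAt r γ - 1) (F χ n))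
    {c₀ c₁ : ℂ_[p]} (hc₀ : c₀ ≠ 0) (hc₁ : c₁ ≠ 0) {δ : HeckeCharacter K → ℂ_[p]}
    (hδ0 : ∀ χ, δ χ ≠ 0) (hδpow : ∀ (χ : HeckeCharacter K) (k : ℕ), δ (χ ^ k) = δ χ ^ k)
    (hG : ∀ (χ : HeckeCharacter K) (n : ℕ), 0 < n → (∀ v : HeightOneSpectrum (𝓞 K), χ.IsUnramifiedAt v) →
      χ.HasInfinityType (fun _ ↦ (n : ℤ)) (fun _ ↦ -(n : ℤ)) →
      ∀ r : FramedGaloisRep K (PadicAlgCl p) 1, IsPAdicAvatarOf ι χ r → FactorsThroughZp κ r →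
        IntSeries.HasValueAt G (avatarValueAt r γ - 1) (c₀ * c₁ ^ n * δ χ * F χ n)) :
    ∃ (U : PowerSeries 𝓞_ℂ_[p]) (c : 𝓞_ℂ_[p]), IsUnit U ∧ c ≠ 0 ∧
      (G = U * (C c * Q) ∨ C c * G = U * Q) := by
  have hp : p.Prime := Fact.out
  -- the interpolation character and its value at `γ`
  obtain ⟨φ₀, m, ψ, hm, hunr, hinf, hav, hfac, hx1, hne⟩ :=
    exists_interpolationCharacter hp2 ι K κ hK hκ γ hγ
  set e := (FramedRep.unitsContinuousMulEquivOfUnique (Fin 1) (PadicAlgCl p) :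
    (PadicAlgCl p)ˣ →ₜ* GL (Fin 1) (PadicAlgCl p)) with he
  set x₀ : ℂ_[p] := avatarValueAt (e.comp ψ) γ with hx₀
  have hunr' : ∀ v : HeightOneSpectrum (𝓞 K), ((p : ℕ) : 𝓞 K) ∉ v.asIdeal → φ₀.IsUnramifiedAt v :=
    fun v _ => hunr v
  -- `a` with `‖x₀^{p^a} − 1‖ < p⁻¹`
  have hpinv : 0 < (p : ℝ)⁻¹ := inv_pos.mpr (by exact_mod_cast hp.pos)
  obtain ⟨a, ha⟩ : ∃ a : ℕ, ‖x₀ ^ p ^ a - 1‖ < (p : ℝ)⁻¹ := by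
    have h := tendsto_pow_prime_pow_padicComplex (p := p) hx1
    have hev := h.eventually (Metric.ball_mem_nhds (1 : ℂ_[p]) hpinv)
    obtain ⟨a, ha⟩ := hev.exists
    exact ⟨a, by rwa [dist_eq_norm] at ha⟩
  set x : ℂ_[p] := x₀ ^ p ^ a with hxdef
  have hxne : x ≠ 1 := hne a
  have hxlt : ‖x - 1‖ < 1 := ha.trans (inv_lt_one_of_one_lt₀ (by exact_mod_cast hp.one_lt))
  have hpt : ∀ j : ℕ, ‖x ^ j - 1‖ < 1 := fun j => (R1.norm_pow_sub_one_le hxlt j).trans_lt hxlt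
  -- the ratio along the test characters
  set b : ℂ_[p] := c₁ ^ (m * p ^ a) * δ φ₀ ^ p ^ a with hbdef
  have hb : b ≠ 0 := mul_ne_zero (pow_ne_zero _ hc₁) (pow_ne_zero _ (hδ0 φ₀))
  -- the two values at `x^j − 1`, `j ≥ 1`, through `φ₀^{p^a j}`
  have key : ∀ j : ℕ, 0 < j → ∃ v : ℂ_[p], IntSeries.HasValueAt Q (x ^ j - 1) v ∧
      IntSeries.HasValueAt G (x ^ j - 1) (c₀ * (b ^ j * v)) := by
    intro j hj
    set n : ℕ := p ^ a * j with hn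
    have hn0 : 0 < m * n := Nat.mul_pos hm (Nat.mul_pos (pow_pos hp.pos a) hj)
    have hunrn : ∀ v : HeightOneSpectrum (𝓞 K), (φ₀ ^ n).IsUnramifiedAt v :=
      fun v => isUnramifiedAt_pow' (hunr v) n
    have hinfn : (φ₀ ^ n).HasInfinityType (fun _ ↦ ((m * n : ℕ) : ℤ)) (fun _ ↦ -((m * n : ℕ) : ℤ)) := by
      have h := HasInfinityType.pow_nat hinf n
      convert h using 2 <;> push_cast <;> ring
    have havn : IsPAdicAvatarOf ι (φ₀ ^ n) (e.comp (ψ ^ n)) := isPAdicAvatarOf_pow ι hav hunr' n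
    have hfacn : FactorsThroughZp κ (e.comp (ψ ^ n)) := factorsThroughZp_unitsChar_pow κ hfac n
    have hvaln : avatarValueAt (e.comp (ψ ^ n)) γ = x ^ j := by
      rw [avatarValueAt_unitsChar_pow, ← hx₀, hxdef, ← pow_mul, hn]
    have h1 := hQ (φ₀ ^ n) (m * n) hn0 hunrn hinfn (e.comp (ψ ^ n)) havn hfacn
    have h2 := hG (φ₀ ^ n) (m * n) hn0 hunrn hinfn (e.comp (ψ ^ n)) havn hfacn
    rw [hvaln] at h1 h2
    have hshape : c₀ * c₁ ^ (m * n) * δ (φ₀ ^ n) * F (φ₀ ^ n) (m * n) =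
        c₀ * (b ^ j * F (φ₀ ^ n) (m * n)) := by
      rw [hδpow, hbdef, hn, mul_pow, ← pow_mul, ← pow_mul]
      ring
    rw [hshape] at h2
    exact ⟨_, h1, h2⟩
  -- generic values of `Q`, `G` at the points `x^j − 1`
  choose V hV using fun j : ℕ => intSeries_exists_hasValueAt Q (hpt j)
  choose V' hV' using fun j : ℕ => intSeries_exists_hasValueAt G (hpt j)
  have hrel : ∀ j, 0 < j → V' j = c₀ * (b ^ j * V j) := by
    intro j hj
    obtain ⟨v, hv, hGv⟩ := key j hj
    rw [(hV j).unique hv]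
    exact (hV' j).unique hGv
  rcases le_or_gt ‖c₀‖ 1 with hle | hlt
  · -- `c₀ ∈ 𝒪_{ℂ_p}`: compare `C(c₀)·Q` with `G`
    set c : 𝓞_ℂ_[p] := ⟨c₀, mem_padicComplexInt_of_norm_le_one hle⟩ with hcdef
    have hVc : ∀ j, IntSeries.HasValueAt (C c * Q) (x ^ j - 1) (c₀ * V j) :=
      fun j => intSeries_hasValueAt_C_mul c (hV j)
    obtain ⟨U, hU, hUQ⟩ := R1.exists_unit_mul_eq_of_values (V := fun j => c₀ * V j) (V' := V')
      ha hxne hb hVc hV' (fun j hj => by rw [hrel j hj]; ring)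
    refine ⟨U, c, hU, ?_, Or.inl hUQ⟩
    intro h
    apply hc₀
    have h' := congrArg (fun z : 𝓞_ℂ_[p] => (z : ℂ_[p])) h
    simpa [hcdef] using h'
  · -- `‖c₀‖ > 1`: `c₀⁻¹ ∈ 𝒪_{ℂ_p}`; compare `Q` with `C(c₀⁻¹)·G`
    have hle : ‖c₀⁻¹‖ ≤ 1 := by
      rw [norm_inv]
      exact inv_le_one_of_one_le₀ hlt.le
    set c : 𝓞_ℂ_[p] := ⟨c₀⁻¹, mem_padicComplexInt_of_norm_le_one hle⟩ with hcdef
    have hVc : ∀ j, IntSeries.HasValueAt (C c * G) (x ^ j - 1) (c₀⁻¹ * V' j) :=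
      fun j => intSeries_hasValueAt_C_mul c (hV' j)
    obtain ⟨U, hU, hUQ⟩ := R1.exists_unit_mul_eq_of_values (V := V) (V' := fun j => c₀⁻¹ * V' j)
      ha hxne hb hV hVc (fun j hj => by
        show c₀⁻¹ * V' j = b ^ j * V j
        rw [hrel j hj, ← mul_assoc, inv_mul_cancel₀ hc₀, one_mul])
    refine ⟨U, c, hU, ?_, Or.inr hUQ⟩
    intro h
    apply inv_ne_zero hc₀
    have h' := congrArg (fun z : 𝓞_ℂ_[p] => (z : ℂ_[p])) h
    simpa [hcdef] using h'

/-- **Ideal form of §1** — the hypothesis `hspan` of `…ConstantScaling.heartShape_of_sockets` with `Q_L := G`,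
`Q_H := Q`: under the hypotheses of `exists_unit_C_mul_eq_of_values_shape` there are `c, c′ ∈ 𝒪_{ℂ_p} ∖ 0` with
`(C(c) · G) = (C(c′) · Q)` as ideals of `𝒪_{ℂ_p}⟦T⟧`. [cite: Castella2018, Thm. 3.1 (arXiv:1704.06608 p. 9)] -/
theorem exists_span_C_mul_eq_of_values_shape (hp2 : p ≠ 2) (hK : IsImaginaryQuadratic K)
    (hκ : κ.IsAnticyclotomic) (hγ : κ.IsTopGenerator γ) {F : HeckeCharacter K → ℕ → ℂ_[p]}
    {Q G : PowerSeries 𝓞_ℂ_[p]}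
    (hQ : ∀ (χ : HeckeCharacter K) (n : ℕ), 0 < n → (∀ v : HeightOneSpectrum (𝓞 K), χ.IsUnramifiedAt v) →
      χ.HasInfinityType (fun _ ↦ (n : ℤ)) (fun _ ↦ -(n : ℤ)) →
      ∀ r : FramedGaloisRep K (PadicAlgCl p) 1, IsPAdicAvatarOf ι χ r → FactorsThroughZp κ r →
        IntSeries.HasValueAt Q (avatarValueAt r γ - 1) (F χ n))
    {c₀ c₁ : ℂ_[p]} (hc₀ : c₀ ≠ 0) (hc₁ : c₁ ≠ 0) {δ : HeckeCharacter K → ℂ_[p]}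
    (hδ0 : ∀ χ, δ χ ≠ 0) (hδpow : ∀ (χ : HeckeCharacter K) (k : ℕ), δ (χ ^ k) = δ χ ^ k)
    (hG : ∀ (χ : HeckeCharacter K) (n : ℕ), 0 < n → (∀ v : HeightOneSpectrum (𝓞 K), χ.IsUnramifiedAt v) →
      χ.HasInfinityType (fun _ ↦ (n : ℤ)) (fun _ ↦ -(n : ℤ)) →
      ∀ r : FramedGaloisRep K (PadicAlgCl p) 1, IsPAdicAvatarOf ι χ r → FactorsThroughZp κ r →
        IntSeries.HasValueAt G (avatarValueAt r γ - 1) (c₀ * c₁ ^ n * δ χ * F χ n)) :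
    ∃ c c' : 𝓞_ℂ_[p], c ≠ 0 ∧ c' ≠ 0 ∧
      Ideal.span ({C c * G} : Set (PowerSeries 𝓞_ℂ_[p])) = Ideal.span {C c' * Q} := by
  obtain ⟨U, c, hU, hc, h | h⟩ :=
    exists_unit_C_mul_eq_of_values_shape hp2 hK hκ hγ hQ hc₀ hc₁ hδ0 hδpow hG
  · refine ⟨1, c, one_ne_zero, hc, ?_⟩
    rw [map_one, one_mul, h]
    exact Ideal.span_singleton_mul_left_unit hU _
  · refine ⟨c, 1, hc, one_ne_zero, ?_⟩
    rw [map_one, one_mul, h]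
    exact Ideal.span_singleton_mul_left_unit hU _

/-! ### §2 Against a Hsieh witness -/

section Hsieh

variable {N : ℕ} {f : CuspForm (CongruenceSubgroup.Gamma0 N) 2} {𝔭 : HeightOneSpectrum (𝓞 K)}
  {A : ℝ} {ΩK CH : ℂ} {Ωp : ℂ_[p]}

/-- **A series whose values on Hsieh's range are Hsieh's values times `c₀ · c₁ⁿ · δ(χ)` generates, up to non-zero
constants, the same ideal as the Hsieh witness**: for `IsHsiehLFunction ι 𝔭 κ γ f A Ω_K C Ω_p Q_H` (Hsieh, Doc.
Math. 19 Thm. A, twisted variable; ANY constants `A, Ω_K, C, Ω_p`) and `G` with values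
`c₀ · c₁ⁿ · δ(χ) · ι⁻¹(hsiehInterpolationValue p f 𝔭 χ n A Ω_K C) · Ω_p^{4n}` (`c₀, c₁ ≠ 0`, `δ` power-multiplicative,
non-vanishing) there are `c, c′ ∈ 𝒪_{ℂ_p} ∖ 0` with `(C(c)·G) = (C(c′)·Q_H)`. Odd `p`, `K` imaginary quadratic,
`κ` anticyclotomic, `γ` a topological generator. [cite: Hsieh2014, Thm. A p. 712 (Doc. Math. 19) = Thm. 1 (arXiv:1112.1580 p. 4)]
[cite: Castella2018, Thm. 3.1 (arXiv:1704.06608 p. 9)] -/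
theorem exists_span_C_mul_eq_of_isHsiehLFunction (hp2 : p ≠ 2) (hK : IsImaginaryQuadratic K)
    (hκ : κ.IsAnticyclotomic) (hγ : κ.IsTopGenerator γ) {QH G : PowerSeries 𝓞_ℂ_[p]}
    (hQH : IsHsiehLFunction ι 𝔭 κ γ f A ΩK CH Ωp QH)
    {c₀ c₁ : ℂ_[p]} (hc₀ : c₀ ≠ 0) (hc₁ : c₁ ≠ 0) {δ : HeckeCharacter K → ℂ_[p]}
    (hδ0 : ∀ χ, δ χ ≠ 0) (hδpow : ∀ (χ : HeckeCharacter K) (k : ℕ), δ (χ ^ k) = δ χ ^ k)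
    (hG : ∀ (χ : HeckeCharacter K) (n : ℕ), 0 < n → (∀ v : HeightOneSpectrum (𝓞 K), χ.IsUnramifiedAt v) →
      χ.HasInfinityType (fun _ ↦ (n : ℤ)) (fun _ ↦ -(n : ℤ)) →
      ∀ r : FramedGaloisRep K (PadicAlgCl p) 1, IsPAdicAvatarOf ι χ r → FactorsThroughZp κ r →
        IntSeries.HasValueAt G (avatarValueAt r γ - 1)
          (c₀ * c₁ ^ n * δ χ *
            ((((ι.symm (hsiehInterpolationValue p f 𝔭 χ n A ΩK CH)) : PadicAlgCl p) : ℂ_[p]) *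
              Ωp ^ (4 * n)))) :
    ∃ c c' : 𝓞_ℂ_[p], c ≠ 0 ∧ c' ≠ 0 ∧
      Ideal.span ({C c * G} : Set (PowerSeries 𝓞_ℂ_[p])) = Ideal.span {C c' * QH} :=
  exists_span_C_mul_eq_of_values_shape hp2 hK hκ hγ
    (F := fun χ n ↦ (((ι.symm (hsiehInterpolationValue p f 𝔭 χ n A ΩK CH)) : PadicAlgCl p) : ℂ_[p]) *
      Ωp ^ (4 * n))
    (fun χ n hn hu hi r hr hf ↦ hQH χ n hn hu hi r hr hf) hc₀ hc₁ hδ0 hδpow hG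

end Hsieh

/-! ### §3 Against a Katz base-change-line series: what remains is the pointwise display relation -/

section Katz

variable {L : Type} [Field L] [NumberField L] [Algebra K L] [IsGalois K L]
  {N : ℕ} {f : CuspForm (CongruenceSubgroup.Gamma0 N) 2} {𝔭 : HeightOneSpectrum (𝓞 K)}
  {A : ℝ} {ΩK CH : ℂ} {Ωp : ℂ_[p]}
  {Sp S T : Finset (HeightOneSpectrum (𝓞 L))} {lam : HeckeCharacter L} {ϑ : L} {CK : ℂ}
  {Ω : InfinitePlace L → ℂ} {ΩpK : InfinitePlace L → ℂ_[p]}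

/-- **V2 socket.** A Katz base-change-line series `G` (`KatzCM.IsBaseChangeLine ι Σ_p S T κ γ λ ϑ C′ Ω Ω_p′ G` on
the line of `K ⊂ L` through `λ`, Hsieh Crelle 688 Prop. 4.9 indexed downstairs) and a Hsieh witness `Q_H`
(`IsHsiehLFunction ι 𝔭 κ γ f A Ω_K C Ω_p Q_H`) generate the same ideal up to non-zero constants —
`(C(c)·G) = (C(c′)·Q_H)`, `c, c′ ∈ 𝒪_{ℂ_p} ∖ 0`, the `hspan` of `heartShape_of_sockets` — PROVIDED the POINTWISE
DISPLAY RELATION `hdisp`: at every `χ` of Hsieh's range (unramified, type `(n, −n)`, `n > 0`) some admissible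
Katz datum `(k, κ, hL)` at `φ = χ` (`k ≥ 1`, `HasKatzType ι Σ_p (λ · χ∘N_{L/K}) k κ`, `hL` an entire continuation
of `L(λ · χ∘N, s)`) has `ι⁻¹(KatzCM.interpolationValue … (L(λ·χ∘N, 0))) · ∏_w Ω_{p,w}′^{k+2κ_w} = c₀ · c₁ⁿ · δ(χ) ·
ι⁻¹(hsiehInterpolationValue p f 𝔭 χ n A Ω_K C) · Ω_p^{4n}` with `c₀, c₁ ≠ 0` and `δ` power-multiplicative and
non-vanishing (e.g. `δ(χ) = ι⁻¹((χ∘N)(ϖ_{𝔓′}))^{−a(λ_{𝔓′})}`, the `ρ`-dependent Euler factor of the Katz display).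
`hdisp` is the layer-2 input (the Katz–Hsieh factorisation of `L(½, π_{f,K′} ⊗ χ)` for the CM form `f`, with the
two displays' constants and `n`-geometric factors sorted into `c₀`, `c₁ⁿ`); NOTHING of it is asserted here.
[cite: Hsieh2014mu, Prop. 4.9 (§4.8)] [cite: Hsieh2014, Thm. A p. 712 (Doc. Math. 19)]
[cite: Castella2018, Thm. 3.1 (arXiv:1704.06608 p. 9)] -/
theorem exists_span_C_mul_eq_of_isBaseChangeLine (hp2 : p ≠ 2) (hK : IsImaginaryQuadratic K)
    (hκ : κ.IsAnticyclotomic) (hγ : κ.IsTopGenerator γ) {QH G : PowerSeries 𝓞_ℂ_[p]}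
    (hQH : IsHsiehLFunction ι 𝔭 κ γ f A ΩK CH Ωp QH)
    (hGK : KatzCM.IsBaseChangeLine ι Sp S T κ γ lam ϑ CK Ω ΩpK G)
    {c₀ c₁ : ℂ_[p]} (hc₀ : c₀ ≠ 0) (hc₁ : c₁ ≠ 0) {δ : HeckeCharacter K → ℂ_[p]}
    (hδ0 : ∀ χ, δ χ ≠ 0) (hδpow : ∀ (χ : HeckeCharacter K) (k : ℕ), δ (χ ^ k) = δ χ ^ k)
    (hdisp : ∀ (χ : HeckeCharacter K) (n : ℕ), 0 < n → (∀ v : HeightOneSpectrum (𝓞 K), χ.IsUnramifiedAt v) →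
      χ.HasInfinityType (fun _ ↦ (n : ℤ)) (fun _ ↦ -(n : ℤ)) →
      ∃ (k : ℕ) (κ_ : InfinitePlace L → ℕ)
        (hL : LFunction.HasEntireContinuation (heckeLFunction (lam * χ.compRelNorm L))),
        1 ≤ k ∧ KatzCM.HasKatzType ι Sp (lam * χ.compRelNorm L) k κ_ ∧
        ((ι.symm (KatzCM.interpolationValue ι Sp S T lam (χ.compRelNorm L) k κ_ ϑ CK Ω
            (hL.continuation 0)) : PadicAlgCl p) : ℂ_[p]) * (∏ w, ΩpK w ^ (k + 2 * κ_ w)) =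
          c₀ * c₁ ^ n * δ χ *
            ((((ι.symm (hsiehInterpolationValue p f 𝔭 χ n A ΩK CH)) : PadicAlgCl p) : ℂ_[p]) *
              Ωp ^ (4 * n))) :
    ∃ c c' : 𝓞_ℂ_[p], c ≠ 0 ∧ c' ≠ 0 ∧
      Ideal.span ({C c * G} : Set (PowerSeries 𝓞_ℂ_[p])) = Ideal.span {C c' * QH} := by
  refine exists_span_C_mul_eq_of_isHsiehLFunction hp2 hK hκ hγ hQH hc₀ hc₁ hδ0 hδpow ?_
  intro χ n hn hu hi r hr hf
  obtain ⟨k, κ_, hL, hk, hT, heq⟩ := hdisp χ n hn hu hi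
  have h := hGK.hasValueAt hr hf hk hT hu hL
  rwa [heq] at h

end Katz

end Summit.BirchSwinnertonDyer.BirchSwinnertonDyer.Theorems.BiquadraticEisensteinDescentEisensteinHeartFlatCMInertBadKPrimeKatzHsiehRigidity

end
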